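/-
Origin: expansion seat `planner-pub-hodgecm-pohl-g12-0`, handover #1 2026-08-18T12:26:35Z (md5 c17a846befbbdba5c0cdfd525cb1b903, 303 l.; RUN 29 additive leaf; lands AFTER pohl-g11 #1 HodgeCM/Proofs/Pohlmann/NonGaloisWitness.lean (de4cdee4); rewrite import Pohl11.NonGaloisWitness -> HodgeCM.Proofs.Pohlmann.NonGaloisWitness x1) (`HOME/pub-hodgecm-pohl-g12/lean/Pohl12/NaiveSpanCriterion.lean`, md5 c17a846b, 303 lines);
landed by the gen-8 packager in gate run 29 as `HodgeCM/Proofs/Pohlmann/NaiveSpanCriterion.lean` (import ^import Pohl11\.NonGaloisWitness[ \t]*$→import HodgeCM.Proofs.Pohlmann.NonGaloisWitness ×1).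
-/
/-
Copyright: pub-hodgecm formalisation cell (harness21, 2026). New file (not vendored).
Origin: HOME/pub-hodgecm-pohl-g12/lean/Pohl12/NaiveSpanCriterion.lean — session planner-pub-hodgecm-pohl-g12-0 (unit pub-hodgecm-pohl-g12),
EXPANSION part (b) `PohlmannSpan`, generation 12.  Intended final place: `HodgeCM/Proofs/Pohlmann/NaiveSpanCriterion.lean`
(module `HodgeCM.Proofs.Pohlmann.NaiveSpanCriterion`).  ADDITIVE leaf; nothing imports it.  Imports: the landed
`HodgeCM.Proofs.Pohlmann.AnyCMFieldNoN4` (run 27) and pohl-g11's RUN-29 row under its WIP name `Pohl11.NonGaloisWitness`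
(ONE import rewrite on landing: `import Pohl11.NonGaloisWitness` → `import HodgeCM.Proofs.Pohlmann.NonGaloisWitness`; lands AFTER it).
-/
import Summits.HodgeConjecture.HodgeCM.Proofs.Pohlmann.AnyCMFieldNoN4
import Summits.HodgeConjecture.HodgeCM.Proofs.Pohlmann.NonGaloisWitness

/-!
# The naive Pohlmann span holds iff the two index sets agree — an exact combinatorial criterion

`Universe.PohlmannSpan` (Geometry/WeightVectors.lean) asserts, for a GALOIS CM field `F` of degree `≥ 6`, the inclusion
`B^p(A′) ⊗ 1 ⊆ span_ℂ {weight vectors of the OLD Hodge weights}` — old = `IsHodgeWeight Θ p S` (CM/LefschetzChar.lean: the count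
`#{(j,s) ∈ S : P s ∈ Θ_j}` equals `p` for EVERY Galois translate `P ∈ GalT F`, i.e. every permutation of `Hom(F, ℂ)` commuting with
pre-composition by `Aut(F/ℚ)`).  Its body at one `(F, Θ, p)` with no hypothesis on `F` is `Universe.NaivePohlmannSpanAt F Θ p`
(NonGaloisIndex.lean; `pohlmannSpan_iff_naive` is `Iff.rfl`).  The CORRECT index set for an arbitrary CM field is `IsHodgeWeightC Θ p S`
(AnyCMField.lean: the same count for every `σ ∈ Gal(E^c/ℚ)`, `E = F^{n+1}` — Gao–Ullmo's condition (3.2),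
`GaoUllmo.isHodgeWeightC_iff_satisfiesEq32`), and with it the span holds for EVERY CM field from `ModelAxioms` + N1 + N2 + N3
(`pohlmannSpanCM_of_facts₃`, AnyCMFieldNoN4.lean).  Always `IsHodgeWeight → IsHodgeWeightC` (`IsHodgeWeight.isHodgeWeightC`).

This file proves that the cohomological statement `NaivePohlmannSpanAt F Θ p` is EQUIVALENT, in every universe with the model axioms
and N1–N3, to a finite combinatorial condition on `(F, Θ, p)` alone:

* `Universe.naivePohlmannSpanAt_iff_indexSetsAgree (M) (hN1) (hN2) (hN3)`:
  `U.NaivePohlmannSpanAt F Θ p ↔ NonGalois.IndexSetsAgree Θ p`, where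
  `IndexSetsAgree Θ p := ∀ S, IsHodgeWeightC Θ p S → IsHodgeWeight Θ p S` (every Galois-closure Hodge weight is an old one).
  (⇐) is monotonicity of `span` applied to `pohlmannSpanCM_of_facts₃`; (⇒), `p ≥ 1`: a Galois-closure Hodge weight `S₀` that is not
  an old one has a weight LINE `V_{S₀}` (`finrank_weightSpace`, N1) inside `B^p ⊗ ℂ = ⨆_{IsHodgeWeightC} V_S`
  (`baseChange_hodgeClassesOf_eq_iSupC_of_pos`, N1–N3), while the naive span puts `B^p ⊗ ℂ` inside `⨆_{S ≠ S₀} V_S`, which meets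
  `V_{S₀}` trivially (`iSupIndep_weightSpace`) — so `V_{S₀} = 0`, absurd; `p = 0`: both sides hold outright.
* Hence the truth value of the naive span does not depend on the universe (`naivePohlmannSpanAt_iff_of_modelAxioms`), it holds
  whenever every Galois translate is induced by `Gal(E^c/ℚ)` (`naivePohlmannSpanAt_of_galTOf_surjective`; for `F` Galois this is
  `GaoUllmo.galTOf_surjective`, giving `PohlmannSpan` once more, `pohlmannSpan_of_indexSetsAgree`), and it FAILS as soon as ONE
  Galois-closure Hodge weight is not an old one (`not_naivePohlmannSpanAt_of_isHodgeWeightC`).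
* The pohl-g9 / pohl-g11 refutation, sharpened: for `Aut(F/ℚ) = {1, c}` and a Galois-stable type `Θ` with two elements `s ≠ t`, the
  mixed weight `{s, t̄}` is a Galois-closure Hodge weight (`isHodgeWeightC_one_of_mem`) but not an old one
  (`NonGalois.not_isHodgeWeight_mixed`: the old ones are the conjugate pairs, `isHodgeWeight_one_iff_pair`) — so the naive span fails at
  `(F, Θ, p = 1)` from `ModelAxioms` + N1–N3 alone, WITHOUT N4 and without the dimension count `g² > g` (`not_naivePohlmannSpanAt₃`);
  with pohl-g11's kernel field `K₂ = ℚ(β₀, i)`: `not_naivePohlmannSpan₃`, `not_naivePohlmannSpan_of_six_le₃` (N4-free forms of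
  `not_naivePohlmannSpan`, `not_naivePohlmannSpan_of_six_le`).

Remark (INFORMAL side computation, recorded for successors; no declaration in this file or elsewhere uses it).  By the criterion, whether
the naive span holds at EVERY `(n, Θ, p)` depends only on the permutation group `Ḡ = Gal(F̃/ℚ) ↷ Hom(F, ℂ)` (`F̃` the Galois closure):
it holds iff every ℚ-combination of the test functions `Q ↦ [Q s ∈ Θ]` (`s ∈ Hom(F, ℂ)`, `Θ` a CM type of `F`) that is constant on `Ḡ`
is constant on `GalT F` — a finite rank computation.  `galTOf` surjective (`Ḡ = GalT F`) is sufficient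
(`naivePohlmannSpanAt_of_galTOf_surjective`) but NOT necessary: over the transitive subgroups of `C₂ ≀ S_g` containing `c`
(script + table `HOME/pub-hodgecm-pohl-g12/sidecalc/`), for `g = 3` the condition fails for exactly ONE of the four conjugacy classes —
order `12`, the Galois-closure type of pohl-g11's `K₂` — and holds for orders `6` (Galois), `24` and `48` (both non-Galois); for `g = 4`
it fails for several and holds for most classes (tables in `sidecalc/`).  Unverified beyond that finite computation; it suggests that
`IsGalois ℚ F` in `PohlmannSpan` is sufficient but not necessary.

Nothing is posited and nothing is cited: every hypothesis is `ModelAxioms` / `Fact_*` (N1 `Fact_cupExterior`, N2 `Fact_cup_hodge`,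
N3 `Fact_pull_H0`) or an explicit hypothesis on `(F, Θ)`; all proofs are kernel-checked from the landed Pohlmann layer.
-/

noncomputable section

open scoped TensorProduct NumberField BigOperators
open NumberField NumberField.ComplexEmbedding

attribute [local instance] Classical.propDecidable

namespace HodgeCM

open Literature.AlgebraicGeometry.Motives (CMType HodgeStructure)
open Literature.AlgebraicGeometry.Motives.HodgeStructure (ofRat ofRat_apply)
open HodgeCM.Pohlmann HodgeCM.GaoUllmo HodgeCM.CMTypeOps

namespace NonGalois

/-! ### The combinatorial condition: the two index sets agree at `(Θ, p)` -/

section Index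

variable {F : Type} [Field F] [NumberField F] {n : ℕ}

/-- **The index sets agree at `(Θ, p)`**: every Galois-closure Hodge weight (`IsHodgeWeightC`, the count condition for
`σ ∈ Gal(E^c/ℚ)`) is an old Hodge weight (`IsHodgeWeight`, the count condition for every Galois translate `P ∈ GalT F`).
The converse implication always holds (`IsHodgeWeight.isHodgeWeightC`), so this says the two index sets of weights COINCIDE.
A finite, decidable-in-principle condition on `(F, Θ, p)`; no universe, no cohomology. -/
def IndexSetsAgree (Θ : Fin (n + 1) → CMType F) (p : ℕ) : Prop :=
  ∀ S : Fin (n + 1) → Finset (F →+* ℂ), IsHodgeWeightC Θ p S → IsHodgeWeight Θ p S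

/-- (Ported verbatim from the HodgeCMPerL package; no docstring in the source.) -/
theorem indexSetsAgree_iff (Θ : Fin (n + 1) → CMType F) (p : ℕ) :
    IndexSetsAgree Θ p ↔ ∀ S : Fin (n + 1) → Finset (F →+* ℂ), IsHodgeWeightC Θ p S ↔ IsHodgeWeight Θ p S :=
  ⟨fun h S => ⟨h S, IsHodgeWeight.isHodgeWeightC⟩, fun h S => (h S).mp⟩

/-- If every Galois translate of `Hom(F, ℂ)` is induced by an element of `Gal(E^c/ℚ)` (`galTOf` surjective), the index sets agree
at every `(Θ, p)` — the proof of `isHodgeWeight_iff_isHodgeWeightC` with its only use of `IsGalois ℚ F` made the hypothesis. -/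
theorem indexSetsAgree_of_galTOf_surjective (h : Function.Surjective (galTOf (F := F) (n := n)))
    (Θ : Fin (n + 1) → CMType F) (p : ℕ) : IndexSetsAgree Θ p :=
  fun _S hS => ⟨hS.1, fun P => by
    obtain ⟨σ, rfl⟩ := h P
    simpa only [galTOf_apply] using hS.2 σ⟩

/-- For `F` Galois over `ℚ` the index sets agree at every `(Θ, p)` (`GaoUllmo.galTOf_surjective`). -/
theorem indexSetsAgree_of_isGalois [IsGalois ℚ F] (Θ : Fin (n + 1) → CMType F) (p : ℕ) : IndexSetsAgree Θ p :=
  indexSetsAgree_of_galTOf_surjective galTOf_surjective Θ p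

/-- At `p = 0` the index sets agree for every `F` and `Θ`: the only weight of total size `0` is the empty one. -/
theorem indexSetsAgree_zero (Θ : Fin (n + 1) → CMType F) : IndexSetsAgree Θ 0 := by
  intro S hS
  have hsum : ∑ j, (S j).card = 0 := by simpa using hS.1
  have h0 : ∀ j, S j = ∅ := fun j =>
    Finset.card_eq_zero.mp (Nat.eq_zero_of_le_zero
      ((Finset.single_le_sum (fun _ _ => Nat.zero_le _) (Finset.mem_univ j)).trans hsum.le))
  exact ⟨hS.1, fun P => by simp [h0]⟩

end Index

/-! ### A Galois-closure Hodge weight that is not an old one: the mixed weight `{s, t̄}` -/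

section Mixed

variable {F : Type} [Field F] [NumberField F] [IsCMField F]

/-- Under `Aut(F/ℚ) = {1, c}`, for two distinct elements `s ≠ t` of a CM type `Θ` the mixed weight `{s, t̄}` on `A_{(F,Θ)}` is NOT an
old Hodge weight of degree `2` (those are exactly the conjugate pairs `{u, ū}`, `isHodgeWeight_one_iff_pair`). -/
theorem not_isHodgeWeight_mixed (hA : AutPair F) (Θ : CMType F) {s t : F →+* ℂ} (hs : s ∈ Θ.1) (ht : t ∈ Θ.1)
    (hst : s ≠ t) : ¬ IsHodgeWeight (fun _ : Fin 1 => Θ) 1 (fun _ => {s, conjugate t}) := by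
  intro h
  obtain ⟨u, hu, hSu⟩ := (isHodgeWeight_one_iff_pair hA Θ _).mp h
  have h' : ({s, conjugate t} : Finset (F →+* ℂ)) = {u, conjugate u} := congr_fun hSu 0
  have hcu : conjugate u ∉ Θ.1 := (mem_iff_conjugate_notMem Θ u).mp hu
  have hct : conjugate t ∉ Θ.1 := (mem_iff_conjugate_notMem Θ t).mp ht
  have hs_mem : s ∈ ({u, conjugate u} : Finset (F →+* ℂ)) := h' ▸ Finset.mem_insert_self _ _
  have ht_mem : conjugate t ∈ ({u, conjugate u} : Finset (F →+* ℂ)) :=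
    h' ▸ Finset.mem_insert_of_mem (Finset.mem_singleton_self _)
  rw [Finset.mem_insert, Finset.mem_singleton] at hs_mem ht_mem
  have h1 : s = u := hs_mem.resolve_right fun h => hcu (h ▸ hs)
  have h2 : t = u := (involutive_conjugate F).injective (ht_mem.resolve_left fun h => hct (h ▸ hu))
  exact hst (h1.trans h2.symm)

/-- Hence for `Aut(F/ℚ) = {1, c}` and a type `Θ` that is Galois-stable up to conjugation with two distinct elements, the index sets
do NOT agree at `(Θ, p = 1)`: `{s, t̄}` is a Galois-closure Hodge weight (`isHodgeWeightC_one_of_mem`) but not an old one. -/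
theorem not_indexSetsAgree_of_autPair (hA : AutPair F) (Θ : CMType F) (hΘ : GalStableType Θ)
    (h2 : ∃ s₁ ∈ Θ.1, ∃ s₂ ∈ Θ.1, s₁ ≠ s₂) : ¬ IndexSetsAgree (fun _ : Fin 1 => Θ) 1 := by
  obtain ⟨s, hs, t, ht, hst⟩ := h2
  exact fun h => not_isHodgeWeight_mixed hA Θ hs ht hst
    (h _ (isHodgeWeightC_one_of_mem Θ hΘ hs ((mem_iff_conjugate_notMem Θ t).mp ht)))

end Mixed

end NonGalois

/-! ### The criterion -/

namespace Universe

open NonGalois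

variable {U : Universe}

section Criterion

variable {F : CMField} {n : ℕ} {Θ : Fin (n + 1) → CMType F}

/-- (⇐) **If the index sets agree at `(Θ, p)`, the naive span holds at `(F, Θ, p)`** in every universe with the model axioms and
N1–N3: the corrected span `pohlmannSpanCM_of_facts₃` and monotonicity of `span`. -/
theorem naivePohlmannSpanAt_of_indexSetsAgree (M : U.ModelAxioms) (hN1 : U.Fact_cupExterior) (hN2 : U.Fact_cup_hodge)
    (hN3 : U.Fact_pull_H0) (p : ℕ) (h : IndexSetsAgree Θ p) : U.NaivePohlmannSpanAt F Θ p := by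
  show _ ≤ _
  refine (pohlmannSpanCM_of_facts₃ M hN1 hN2 hN3 F n Θ p).trans fun v hv => ?_
  rw [Submodule.restrictScalars_mem] at hv ⊢
  refine Submodule.span_mono ?_ hv
  rintro x ⟨S, hS, hx⟩
  exact ⟨S, h S hS, hx⟩

/-- (⇒) **If the naive span holds at `(F, Θ, p)`, `p ≥ 1`, in SOME universe with the model axioms and N1–N3, the index sets agree
at `(Θ, p)`.**  A Galois-closure Hodge weight `S₀` that is not an old one spans a line `V_{S₀} ⊆ B^p ⊗ ℂ` which the naive span forces
into `⨆_{S ≠ S₀} V_S`; distinct weights have independent weight spaces, so `V_{S₀} = 0` — contradiction. -/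
theorem indexSetsAgree_of_naivePohlmannSpanAt (M : U.ModelAxioms) (hN1 : U.Fact_cupExterior) (hN2 : U.Fact_cup_hodge)
    (hN3 : U.Fact_pull_H0) {p : ℕ} (hp : 0 < p) (h : U.NaivePohlmannSpanAt F Θ p) : IndexSetsAgree Θ p := by
  intro S₀ hS₀
  by_contra hnot
  -- `V_{S₀}` is a line (N1: weights of total size `2p` have one-dimensional weight spaces in degree `2p ≥ 1`)
  have h1 : Module.finrank ℂ (U.weightSpace F Θ S₀ (2 * p)) = 1 := by
    rw [finrank_weightSpace M hN1 (by omega) S₀, if_pos hS₀.1]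
  -- `V_{S₀} ⊆ B^p ⊗ ℂ` (Pohlmann's equality for the corrected index set, N1–N3)
  have h2 : U.weightSpace F Θ S₀ (2 * p) ≤ (U.hodgeClassesOf (U.cmProd F Θ) p).baseChange ℂ := by
    rw [baseChange_hodgeClassesOf_eq_iSupC_of_pos M hN1 hN2 hN3 hp]
    exact le_iSup₂_of_le S₀ hS₀ le_rfl
  -- the span of the old weight vectors lies in `⨆_{S ≠ S₀} V_S`, because `S₀` is not an old Hodge weight
  have hOld : Submodule.span ℂ {x : U.CohC (U.cmProd F Θ) (2 * p) |
      ∃ S : Fin (n + 1) → Finset ((F : Type) →+* ℂ), IsHodgeWeight Θ p S ∧ U.IsWeightVector F Θ S (2 * p) x} ≤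
      ⨆ (S : Fin (n + 1) → Finset ((F : Type) →+* ℂ)) (_ : S ≠ S₀), U.weightSpace F Θ S (2 * p) := by
    rw [Submodule.span_le]
    rintro x ⟨S, hS, hx⟩
    have hne : S ≠ S₀ := fun he => hnot (he ▸ hS)
    have hle : U.weightSpace F Θ S (2 * p) ≤
        ⨆ (S : Fin (n + 1) → Finset ((F : Type) →+* ℂ)) (_ : S ≠ S₀), U.weightSpace F Θ S (2 * p) :=
      le_iSup₂_of_le S hne le_rfl
    exact hle ((U.mem_weightSpace_iff F Θ S (2 * p) x).2 hx)
  -- the naive span: `B^p ⊗ ℂ ⊆ span {old weight vectors}`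
  have hB : (U.hodgeClassesOf (U.cmProd F Θ) p).baseChange ℂ ≤
      Submodule.span ℂ {x : U.CohC (U.cmProd F Θ) (2 * p) |
        ∃ S : Fin (n + 1) → Finset ((F : Type) →+* ℂ), IsHodgeWeight Θ p S ∧ U.IsWeightVector F Θ S (2 * p) x} := by
    rw [Submodule.baseChange_eq_span, Submodule.span_le]
    intro x hx
    exact h hx
  -- independence of the weight spaces of distinct weights
  have h5 : Disjoint (U.weightSpace F Θ S₀ (2 * p))
      (⨆ (S : Fin (n + 1) → Finset ((F : Type) →+* ℂ)) (_ : S ≠ S₀), U.weightSpace F Θ S (2 * p)) :=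
    iSupIndep_weightSpace (F := F) (Θ := Θ) M (2 * p) S₀
  have h6 : U.weightSpace F Θ S₀ (2 * p) = ⊥ := h5.eq_bot_of_le (h2.trans (hB.trans hOld))
  rw [h6, finrank_bot] at h1
  exact zero_ne_one h1

/-- **THE CRITERION.**  In every universe with the model axioms and N1–N3, for every CM field `F`, every family of CM types `Θ` and
every `p`: the naive Pohlmann span holds at `(F, Θ, p)` IFF the two index sets agree at `(Θ, p)`. -/
theorem naivePohlmannSpanAt_iff_indexSetsAgree (M : U.ModelAxioms) (hN1 : U.Fact_cupExterior) (hN2 : U.Fact_cup_hodge)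
    (hN3 : U.Fact_pull_H0) (p : ℕ) : U.NaivePohlmannSpanAt F Θ p ↔ IndexSetsAgree Θ p := by
  refine ⟨fun h => ?_, naivePohlmannSpanAt_of_indexSetsAgree M hN1 hN2 hN3 p⟩
  rcases Nat.eq_zero_or_pos p with rfl | hp
  · exact indexSetsAgree_zero Θ
  · exact indexSetsAgree_of_naivePohlmannSpanAt M hN1 hN2 hN3 hp h

/-- **Absoluteness.**  The truth value of the naive span at `(F, Θ, p)` is the same in ALL universes satisfying the model axioms and
N1–N3 (it is the combinatorial condition `IndexSetsAgree Θ p`). -/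
theorem naivePohlmannSpanAt_iff_of_modelAxioms {U' : Universe} (M : U.ModelAxioms) (hN1 : U.Fact_cupExterior)
    (hN2 : U.Fact_cup_hodge) (hN3 : U.Fact_pull_H0) (M' : U'.ModelAxioms) (hN1' : U'.Fact_cupExterior)
    (hN2' : U'.Fact_cup_hodge) (hN3' : U'.Fact_pull_H0) (p : ℕ) :
    U.NaivePohlmannSpanAt F Θ p ↔ U'.NaivePohlmannSpanAt F Θ p :=
  (naivePohlmannSpanAt_iff_indexSetsAgree M hN1 hN2 hN3 p).trans
    (naivePohlmannSpanAt_iff_indexSetsAgree M' hN1' hN2' hN3' p).symm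

/-- **Sufficient: every Galois translate is a Galois element.**  If `galTOf : Gal(E^c/ℚ) → GalT F` is onto (`E = F^{n+1}`), the naive
span holds at every `(Θ, p)` on `n + 1` factors — the exact consequence of `IsGalois ℚ F` that the landed proofs of `PohlmannSpan` use. -/
theorem naivePohlmannSpanAt_of_galTOf_surjective (M : U.ModelAxioms) (hN1 : U.Fact_cupExterior) (hN2 : U.Fact_cup_hodge)
    (hN3 : U.Fact_pull_H0) (hF : Function.Surjective (galTOf (F := (F : Type)) (n := n))) (p : ℕ) :
    U.NaivePohlmannSpanAt F Θ p :=
  naivePohlmannSpanAt_of_indexSetsAgree M hN1 hN2 hN3 p (indexSetsAgree_of_galTOf_surjective hF Θ p)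

/-- **Necessary: no Galois-closure Hodge weight outside the old index set.**  One weight `S` with `IsHodgeWeightC Θ p S` and
`¬ IsHodgeWeight Θ p S` refutes the naive span at `(F, Θ, p)` in every universe with the model axioms and N1–N3. -/
theorem not_naivePohlmannSpanAt_of_isHodgeWeightC (M : U.ModelAxioms) (hN1 : U.Fact_cupExterior) (hN2 : U.Fact_cup_hodge)
    (hN3 : U.Fact_pull_H0) {p : ℕ} {S : Fin (n + 1) → Finset ((F : Type) →+* ℂ)} (hC : IsHodgeWeightC Θ p S)
    (hS : ¬ IsHodgeWeight Θ p S) : ¬ U.NaivePohlmannSpanAt F Θ p :=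
  fun h => hS ((naivePohlmannSpanAt_iff_indexSetsAgree M hN1 hN2 hN3 p).mp h S hC)

end Criterion

/-- `PohlmannSpan` once more, through the criterion: for Galois `F` the index sets agree (`indexSetsAgree_of_isGalois`);
the degree hypothesis is not used.  (Same statement as `pohlmannSpan_of_facts₃`; recorded to show the criterion subsumes it.) -/
theorem pohlmannSpan_of_indexSetsAgree (M : U.ModelAxioms) (hN1 : U.Fact_cupExterior) (hN2 : U.Fact_cup_hodge)
    (hN3 : U.Fact_pull_H0) : U.PohlmannSpan :=
  fun _F _hG _h6 _n Θ p => naivePohlmannSpanAt_of_indexSetsAgree M hN1 hN2 hN3 p (indexSetsAgree_of_isGalois Θ p)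

/-! ### The refutation off the Galois case, N4-free and without the dimension count -/

/-- **The naive span fails at `(F, Θ, 1)`** for `Aut(F/ℚ) = {1, c}`, `Θ` Galois-stable up to conjugation with two distinct elements, in
every universe with the model axioms and N1–N3 (pohl-g9's `not_naivePohlmannSpanAt` without N4 `Fact_hodge_F0`: the witness is the
single mixed weight `{s, t̄}`, not the count `g² > g`). -/
theorem not_naivePohlmannSpanAt₃ (M : U.ModelAxioms) (hN1 : U.Fact_cupExterior) (hN2 : U.Fact_cup_hodge)
    (hN3 : U.Fact_pull_H0) (F : CMField) (hA : AutPair F) (Θ : CMType F) (hΘ : GalStableType Θ)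
    (h2 : ∃ s₁ ∈ Θ.1, ∃ s₂ ∈ Θ.1, s₁ ≠ s₂) : ¬ U.NaivePohlmannSpanAt F (fun _ : Fin 1 => Θ) 1 :=
  fun h => not_indexSetsAgree_of_autPair hA Θ hΘ h2
    ((naivePohlmannSpanAt_iff_indexSetsAgree M hN1 hN2 hN3 1).mp h)

/-- … in particular at an induced type of a CM field of degree `≥ 4` with `Aut(F/ℚ) = {1, c}` (N4-free `not_naivePohlmannSpanAt_subfieldType`). -/
theorem not_naivePohlmannSpanAt_subfieldType₃ (M : U.ModelAxioms) (hN1 : U.Fact_cupExterior) (hN2 : U.Fact_cup_hodge)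
    (hN3 : U.Fact_pull_H0) (F : CMField) (hA : AutPair F) (h4 : 4 ≤ Module.finrank ℚ F)
    {K : Type} [Field K] (i : K →+* F) (k₀ : K →+* ℂ) (hK : ∀ k : K →+* ℂ, k = k₀ ∨ k = conjugate k₀) (hk : conjugate k₀ ≠ k₀) :
    ¬ U.NaivePohlmannSpanAt F (fun _ : Fin 1 => subfieldType i k₀ hK hk) 1 :=
  not_naivePohlmannSpanAt₃ M hN1 hN2 hN3 F hA _ (galStableType_subfieldType i k₀ hK hk) (exists_ne_of_four_le _ h4)

open SexticCM in
/-- … and at pohl-g11's kernel witness `(K₂ = ℚ(β₀, i), Θ₂, p = 1)` (N4-free `not_naivePohlmannSpanAt_K₂`). -/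
theorem not_naivePohlmannSpanAt_K₂₃ (M : U.ModelAxioms) (hN1 : U.Fact_cupExterior) (hN2 : U.Fact_cup_hodge)
    (hN3 : U.Fact_pull_H0) : ¬ U.NaivePohlmannSpanAt K₂CM (fun _ : Fin 1 => thetaK₂) 1 :=
  not_naivePohlmannSpanAt_subfieldType₃ M hN1 hN2 hN3 K₂CM autPair_K₂ (by rw [finrank_K₂CM]; norm_num)
    QiToK₂ (algebraMap Qi ℂ) emb_Qi conjugate_Qi_ne

open SexticCM in
/-- **`PohlmannSpan` without its hypotheses on `F` is false in every universe with the model axioms and N1–N3** (N4-free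
`not_naivePohlmannSpan`): the naive span fails at `(K₂, Θ₂, p = 1)`. -/
theorem not_naivePohlmannSpan₃ (M : U.ModelAxioms) (hN1 : U.Fact_cupExterior) (hN2 : U.Fact_cup_hodge)
    (hN3 : U.Fact_pull_H0) :
    ¬ ∀ (F : CMField) (n : ℕ) (Θ : Fin (n + 1) → CMType F) (p : ℕ), U.NaivePohlmannSpanAt F Θ p :=
  fun h => not_naivePohlmannSpanAt_K₂₃ M hN1 hN2 hN3 (h K₂CM 0 _ 1)

open SexticCM in
/-- … and keeping only the degree hypothesis `6 ≤ [F:ℚ]` does not rescue it (N4-free `not_naivePohlmannSpan_of_six_le`). -/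
theorem not_naivePohlmannSpan_of_six_le₃ (M : U.ModelAxioms) (hN1 : U.Fact_cupExterior) (hN2 : U.Fact_cup_hodge)
    (hN3 : U.Fact_pull_H0) :
    ¬ ∀ (F : CMField), 6 ≤ Module.finrank ℚ F →
      ∀ (n : ℕ) (Θ : Fin (n + 1) → CMType F) (p : ℕ), U.NaivePohlmannSpanAt F Θ p :=
  fun h => not_naivePohlmannSpanAt_K₂₃ M hN1 hN2 hN3 (h K₂CM finrank_K₂CM.ge 0 _ 1)

open SexticCM in
/-- At pohl-g11's witness the index sets DISAGREE at `p = 1` — the combinatorial content of the refutation, no universe involved. -/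
theorem not_indexSetsAgree_K₂ : ¬ IndexSetsAgree (fun _ : Fin 1 => thetaK₂) 1 :=
  not_indexSetsAgree_of_autPair autPair_K₂ thetaK₂ (galStableType_subfieldType _ _ _ _)
    (exists_ne_of_four_le _ (by show 4 ≤ Module.finrank ℚ K₂; rw [finrank_K₂]; norm_num))

end Universe

end HodgeCM

end
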